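import Summits.ValiantsHypothesis.ValiantsHypothesis.Theorems.LacunarySymmetroidMatrixDescartesFiniteSectorHeightDefs

/-!
# `MatrixDescartes` — DEFECT vocabulary of line «defect» (val-idea-6 g4, LINE 3): the arc points and nodes of the unit
# circle, the reflection in the unit circle, the two typed defect laws (STUB 1 interpolation — proved in the port —
# and STUB 2 capacity — open, recorded), and the positive row package `NearFullHeightRow`

HONEST FRAMING.  Definitions-only companion (D-0009) for the port of the THEOREMS of the crux workfile
`Cruxes/MatrixDescartes/Lines/defect.lean` v2.1 (val-idea-6 g4, lens «assume the law fails» + control quantity;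
val-idea-crit-1 VERDICT #25 = PASS, structure + instrument tier, 0 seats; porter val-port-1, val-lit desk g11 pool) into
`Theorems/` (`…DefectLaw.lean` §1–§4, `…DefectLawPencil.lean` §5–§7, and the §8–§10 interpolation files).  Crux:
`Summit.ValiantsHypothesis.ValiantsHypothesis.Theses.LacunarySymmetroid.MatrixDescartes` (`stmt-ValiantsHypothesis-18050`),
asymptotic in `K` and HEIGHT-FREE; everything in this line is height-sensitive and lives on the NEAR-FULL sector, so
NOTHING here bears on the crux or on `VP ≠ VNP`.  NOTHING is proved or claimed here: `InterpolationDefectLaw` (STUB 1)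
is PROVED in the port (`…interpolationDefectLaw_holds`), `CapacityDefectLaw` (STUB 2, the optimal constant of the
method, a classical potential-theory statement whose typing cost is the only risk) is OPEN and recorded as a `def`,
never asserted.  Vocabulary reused BY NAME: `pencil`, `l1` (`…FiniteSectorDefs` / `…FiniteSectorHeightDefs`).  Texts are
the workfile's verbatim up to that renaming (the workfile's local `l1`, `pencil`, `Rrep` copies are NOT re-declared).
[folklore] Elementary vocabulary (points of the unit circle, equally spaced nodes of an arc, inversion in the circle).
-/

-- `Summit.ValiantsHypothesis.ValiantsHypothesis.…` repeats a component by the D-0017 layout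
-- (single-conjunct summit), which the `dupNamespace` linter flags; the name is mandated.
set_option linter.dupNamespace false

noncomputable section

namespace Summit.ValiantsHypothesis.ValiantsHypothesis.Theorems.LacunarySymmetroidMatrixDescartes.Defect

open Summit.ValiantsHypothesis.ValiantsHypothesis.Theorems.LacunarySymmetroidMatrixDescartes.FiniteSector
open scoped BigOperators Matrix
open Polynomial

/-! ## Line «defect» §2–§3: geometry on the unit circle -/

/-- The arc point `e^{iθ}` of the unit circle (line «defect» §2, verbatim). [folklore] -/
def arc (θ : ℝ) : ℂ := Complex.exp (θ * Complex.I)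

/-- The `D + 1` equally spaced points `π − φ + (2φ/D)·i`, `i = 0 … D`, of the arc `|θ − π| ≤ φ` (line «defect» §3,
verbatim). [folklore] -/
def node (φ : ℝ) (D : ℕ) (i : Fin (D + 1)) : ℝ := Real.pi - φ + 2 * φ / D * (i : ℕ)

/-! ## Line «defect» §8: reflection in the unit circle -/

/-- Reflection in the unit circle for the large roots: `β♯ = β` if `‖β‖ ≤ 1`, else `1/β̄` (line «defect» §8, verbatim).
[folklore] -/
def refl (β : ℂ) : ℂ := if ‖β‖ ≤ 1 then β else ((starRingEnd ℂ) β)⁻¹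

/-! ## Line «defect» §7: the two typed defect laws -/

/-- **STUB 1 of line «defect» — the INTERPOLATION (linear-in-defect) law** (§7, verbatim; PROVED in the port as
`…Defect.interpolationDefectLaw_holds`): for every real `f ≠ 0`, every finset `A` of positive roots of `f`, defect
`D = deg f − |A| ≥ 1` and `0 < φ ≤ π/2`,
`√|c₀·lc| · (2cos(φ/2))^{|A|} · (2φ/(πD))^D · D!/(D+1) ≤ ‖f‖₁` — at `φ = 1`: `0.81·Z₊ ≤ log₂R + 2.1·D + log₂(D+1)`,
a fixed cost per positive root and a fixed refund per wasted root, uniformly in the degree.  Mechanism: Lagrange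
interpolation of the reflected residual factor at the `D+1` arc nodes.
[statement of the cell's line «defect» (val-idea-6 g4); no citation exists] -/
def InterpolationDefectLaw : Prop :=
  ∀ (f : ℝ[X]), f ≠ 0 → ∀ (A : Finset ℝ), (∀ a ∈ A, 0 < a ∧ f.IsRoot a) →
    ∀ D : ℕ, f.natDegree = A.card + D → 1 ≤ D → ∀ φ : ℝ, 0 < φ → φ ≤ Real.pi / 2 →
      Real.sqrt |f.coeff 0 * f.leadingCoeff| * ((2 * Real.cos (φ / 2)) ^ A.card *
        ((2 * φ / (Real.pi * D)) ^ D * (D.factorial : ℝ) / (D + 1))) ≤ l1 f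

/-- **STUB 2 of line «defect» — the CAPACITY defect law** (§7, verbatim; OPEN in the tree — recorded as a proposition,
never asserted): the optimal constant of the method, `sin(φ/2)^D` in place of STUB 1's `(2φ/(πD))^D·D!/(D+1)`, for
`0 < φ ≤ π`; at `φ = π/2` it reads as the EXCESS LAW `Z₊ − D ≤ 2·log₂(‖f‖₁/√|c₀·lc|)`.  On paper this is the classical
lower bound `max_E |P| ≥ cap(E)^{deg P}` for monic `P` on an arc `E` of the unit circle (logarithmic capacity of an arc
of angular measure `α` is `sin(α/4)`); logarithmic capacity is not in Mathlib, so the typing cost is the open part.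
The port proves the pigeonhole-constant version `…Defect.excessLaw` and the interpolation version instead.
[statement of the cell's line «defect» (val-idea-6 g4), STUB 2; no citation exists] -/
def CapacityDefectLaw : Prop :=
  ∀ (f : ℝ[X]), f ≠ 0 → ∀ (A : Finset ℝ), (∀ a ∈ A, 0 < a ∧ f.IsRoot a) →
    ∀ D : ℕ, f.natDegree = A.card + D → ∀ φ : ℝ, 0 < φ → φ ≤ Real.pi →
      Real.sqrt |f.coeff 0 * f.leadingCoeff| * ((2 * Real.cos (φ / 2)) ^ A.card * Real.sin (φ / 2) ^ D) ≤ l1 f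

/-! ## Line «defect» §10: positive packaging of the near-full height rows -/

/-- **Near-full height row** `NearFullHeightRow K Z D H` (line «defect» §10, verbatim; crit-1 VERDICT #25 port note):
NO pencil `Σ_{l<K} t^{d_l} S_l` of real `2×2` letters with entries `≤ H` has a set of `Z` distinct positive roots of
`det`, degree exactly `Z + D` and integer-normalised ends `|c₀·lc| ≥ 1` (exponents `d` arbitrary; letters need not be
symmetric).  So the minimal admissible integer height of such a pencil is `H + 1`. [folklore] -/
def NearFullHeightRow (K Z D : ℕ) (H : ℝ) : Prop :=
  ∀ (d : Fin K → ℕ) (S : Fin K → Matrix (Fin 2) (Fin 2) ℝ), (∀ l i j, |S l i j| ≤ H) →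
    ∀ A : Finset ℝ, A.card = Z → (∀ a ∈ A, 0 < a) → (∀ a ∈ A, (pencil d S).det.IsRoot a) →
      (pencil d S).det.natDegree = Z + D →
        1 ≤ |(pencil d S).det.coeff 0 * (pencil d S).det.leadingCoeff| → False

end Summit.ValiantsHypothesis.ValiantsHypothesis.Theorems.LacunarySymmetroidMatrixDescartes.Defect

end
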